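import Literature.Probability.LatticeModels.KCBoundaryDirichlet
import Literature.Probability.LatticeModels.KCSectionFamilyMaxPrinciple
import HarnessLib

/-!
# Families of spin-fermion data with background spins, IV: the Dirichlet boundary condition of the limit

Topic `Literature/Probability/LatticeModels`. Chelkak–Hongler–Izyurov 2015, proof of Thm 2.16
(§3.4), property (1) of Prop. 3.9: from the a-priori bound `|H_δ| ≤ C(ε)` on `Ω_δ(ε)` (up to the
boundary) and the Dirichlet condition `H_δ = 0` on `∂Ω_δ`, the two-constant bounds (3.20) and the weak
Beurling estimate give `H_δ → 0` near `∂Ω` uniformly in `δ`, whence `h̃ ≡ 0` on `∂Ω`. This file is the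
mesh form for a family `𝓕 : KCSectionFamily` (`KCSectionFamily.lean`) whose volumes are hole-free,
whose plaquette set is the filled set of touching plaquettes, with odd cuts off a source plaquette
`p₀ δ` and the Dirichlet normalisation `Hw δ = c δ` on the frozen corners:

* `exists_frozen_neighbour` (a frozen site of a hole-free volume has a frozen neighbour),
  `mul_abs_coord_sub_le_dist`, `mem_sqBox_of_dist_meshPoint_le`, `dist_meshPoint_le_two_mul_of_mem_sqBox` (lattice
  boxes versus Euclidean distances);
* **`KCSectionFamily.boundary_smallness`**: if the boundary is VISIBLE at scale `δ` (every point off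
  `Ω` is within `C₀ δ` of a frozen site), the background spins and the source stay `2ε₁` inside, and
  the a-priori bound `|Hw - c|, |Hb - c| ≤ M · N δ` holds on the collar `{infDist(·, Ωᶜ) ≤ ε₁}`, then
  for every `η > 0` there is `d > 0` such that, for all small `δ`, `|Hw δ y - c δ| ≤ η · M · N δ` at
  every free site `y` with `infDist (meshPoint δ y) Ωᶜ ≤ d` (`le_hw_near_frozen` below,
  `hb_le_near_frozen` and `Hw ≤ Hb` above — the modified-Laplacian route, no jump term).

Everything is proved; no named fact.

## References

* D. Chelkak, C. Hongler, K. Izyurov, Ann. of Math. 181 (2015), Prop. 3.6, Remark 3.7, §3.4 (3.20)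
  [ChelkakHonglerIzyurovAnnals2015].
* S. Smirnov, Ann. of Math. 172 (2010), App. B, Lemma B.2 [Smirnov2010].
-/

noncomputable section

namespace Literature.Probability.LatticeModels

open Filter _root_.Topology Metric Set Finset Complex SimpleGraph WeakBeurling

/-! ### Lattice boxes versus Euclidean distances -/

/-- A frozen site of a hole-free volume has a frozen neighbour. [folklore] -/
theorem exists_frozen_neighbour {Λ : Finset (Site 2)} (hΛ : HoleFree (↑Λ : Set (Site 2))) {p : Site 2} (hp : p ∉ Λ) :
    ∃ k : Fin 4, p + cornerUnit k ∉ Λ := by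
  obtain ⟨g', hg', hchain⟩ := hΛ p hp (p 1 + 1)
  rcases Relation.ReflTransGen.cases_head hchain with h | ⟨p', hstep, -⟩
  · exfalso; rw [h] at hg'; omega
  · obtain ⟨k, hk⟩ := exists_eq_add_cornerUnit_of_adj hstep.1
    exact ⟨k, hk ▸ fun h => hstep.2.2 h⟩

/-- Coordinates are controlled by the Euclidean distance of mesh points:
`δ |y i - p i| ≤ dist (meshPoint δ y) (meshPoint δ p)`. [folklore] -/
theorem mul_abs_coord_sub_le_dist {δ : ℝ} (hδ : 0 ≤ δ) (y p : Site 2) (i : Fin 2) :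
    δ * |((y i : ℤ) : ℝ) - p i| ≤ dist (meshPoint δ y) (meshPoint δ p) := by
  rw [Complex.dist_eq]
  have h0 : |δ * ((y 0 : ℝ) - p 0)| ≤ ‖meshPoint δ y - meshPoint δ p‖ := by
    have h := Complex.abs_re_le_norm (meshPoint δ y - meshPoint δ p)
    simp only [Complex.sub_re, meshPoint_re] at h
    rwa [← mul_sub] at h
  have h1 : |δ * ((y 1 : ℝ) - p 1)| ≤ ‖meshPoint δ y - meshPoint δ p‖ := by
    have h := Complex.abs_im_le_norm (meshPoint δ y - meshPoint δ p)
    simp only [Complex.sub_im, meshPoint_im] at h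
    rwa [← mul_sub] at h
  have key : |δ * ((y i : ℝ) - p i)| ≤ ‖meshPoint δ y - meshPoint δ p‖ := by
    fin_cases i
    · exact h0
    · exact h1
  rwa [abs_mul, abs_of_nonneg hδ] at key

/-- A site whose mesh point is within `δ n` of that of `p` lies in `sqBox p n`. [folklore] -/
theorem mem_sqBox_of_dist_meshPoint_le {δ : ℝ} (hδ : 0 < δ) {y p : Site 2} {n : ℤ}
    (h : dist (meshPoint δ y) (meshPoint δ p) ≤ δ * n) : y ∈ sqBox p n := by
  rw [mem_sqBox]
  have key : ∀ i : Fin 2, |y i - p i| ≤ n := fun i => by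
    have h1 := (mul_abs_coord_sub_le_dist hδ.le y p i).trans h
    have h2 : |((y i : ℤ) : ℝ) - p i| ≤ n := le_of_mul_le_mul_left h1 hδ
    exact_mod_cast h2
  exact ⟨key 0, key 1⟩

/-- Sites of `sqBox p n` have mesh points within `2 δ n` of that of `p`. [folklore] -/
theorem dist_meshPoint_le_two_mul_of_mem_sqBox {δ : ℝ} (hδ : 0 ≤ δ) {y p : Site 2} {n : ℤ} (h : y ∈ sqBox p n) :
    dist (meshPoint δ y) (meshPoint δ p) ≤ 2 * δ * n := by
  rw [mem_sqBox] at h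
  have h0 : (|y 0 - p 0| : ℝ) ≤ n := by exact_mod_cast h.1
  have h1 : (|y 1 - p 1| : ℝ) ≤ n := by exact_mod_cast h.2
  have key := dist_meshPoint_le_abs_add_abs δ y (meshPoint δ p)
  simp only [meshPoint_re, meshPoint_im] at key
  rw [← mul_sub, ← mul_sub, abs_mul, abs_mul, abs_of_nonneg hδ] at key
  nlinarith [key, abs_nonneg ((y 0 : ℝ) - p 0), abs_nonneg ((y 1 : ℝ) - p 1)]

/-- The plaquette `faceAt p k` lies in `sqBox p 1`. [folklore] -/
theorem faceAt_mem_sqBox_one (p : Site 2) (k : Fin 4) : faceAt p k ∈ sqBox p 1 := by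
  rw [mem_sqBox]
  have h0 := cornerOff_apply_zero_or_one k 0
  have h1 := cornerOff_apply_zero_or_one k 1
  simp only [faceAt, Pi.sub_apply]
  constructor
  · rcases h0 with h | h <;> rw [h] <;> simp
  · rcases h1 with h | h <;> rw [h] <;> simp

/-- Boxes about `faceAt p k` sit in boxes about `p` one unit larger. [folklore] -/
theorem sqBox_faceAt_subset (p : Site 2) (k : Fin 4) (n : ℤ) : sqBox (faceAt p k) n ⊆ sqBox p (n + 1) := by
  intro z hz
  have hf := faceAt_mem_sqBox_one p k
  simp only [mem_sqBox, abs_le] at hz hf ⊢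
  omega

/-- Boxes about `p` sit in boxes about `faceAt p k` one unit larger. [folklore] -/
theorem sqBox_subset_sqBox_faceAt (p : Site 2) (k : Fin 4) (n : ℤ) : sqBox p n ⊆ sqBox (faceAt p k) (n + 1) := by
  intro z hz
  have hf := faceAt_mem_sqBox_one p k
  simp only [mem_sqBox, abs_le] at hz hf ⊢
  omega

/-- The decay profiles vanish at `0⁺`: `C (κ d)^β + A (κ d)^γ → 0` as `d → 0`. [folklore] -/
theorem tendsto_decay_profiles (κ : ℝ) :
    Tendsto (fun d : ℝ => beurlingConst * (κ * d) ^ beurlingExp + endDecayConst * (κ * d) ^ endDecayExp) (𝓝 0) (𝓝 0) := by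
  have hβ := beurlingExp_pos
  have hγ := endDecayExp_pos
  have hlin : Tendsto (fun d : ℝ => κ * d) (𝓝 0) (𝓝 0) := by
    simpa using ((tendsto_id (x := 𝓝 (0 : ℝ))).const_mul κ)
  have h1 : Tendsto (fun d : ℝ => (κ * d) ^ beurlingExp) (𝓝 0) (𝓝 0) := by
    have := (Real.continuousAt_rpow_const 0 beurlingExp (Or.inr hβ.le)).tendsto.comp hlin
    simpa [Function.comp_def, Real.zero_rpow hβ.ne'] using this
  have h2 : Tendsto (fun d : ℝ => (κ * d) ^ endDecayExp) (𝓝 0) (𝓝 0) := by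
    have := (Real.continuousAt_rpow_const 0 endDecayExp (Or.inr hγ.le)).tendsto.comp hlin
    simpa [Function.comp_def, Real.zero_rpow hγ.ne'] using this
  simpa using (h1.const_mul beurlingConst).add (h2.const_mul endDecayConst)

/-- Arithmetic of the radii: `ρ + 3 ≤ R`. [folklore] -/
theorem aux_rho_add_three_le {d δ C₀ ε₁ ρ R : ℝ} (hδ0 : 0 < δ) (hε₁ : 0 < ε₁) (hdε : d < ε₁ / 16) (hδε : (C₀ + 5) * δ < ε₁ / 16)
    (hρlt : ρ < (2 * d + C₀ * δ) / δ + 1) (hRlt : ε₁ / (4 * δ) < R + 1) : ρ + 3 ≤ R := by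
  have h1 : ρ * δ < 2 * d + C₀ * δ + δ := by
    have := mul_lt_mul_of_pos_right hρlt hδ0
    rwa [add_mul, div_mul_cancel₀ _ hδ0.ne', one_mul] at this
  have h2 : ε₁ / 4 < (R + 1) * δ := by
    have := mul_lt_mul_of_pos_right hRlt hδ0
    rwa [show ε₁ / (4 * δ) * δ = ε₁ / 4 by field_simp] at this
  have h3 : (ρ + 3) * δ < R * δ := by linarith
  by_contra hlt
  push Not at hlt
  have : R * δ < (ρ + 3) * δ := mul_lt_mul_of_pos_right hlt hδ0
  linarith

/-- Arithmetic of the ratios: `x / z ≤ κ d` for `x ≤ ρ + 2`, `z ≥ ε₁/(8δ)`, `κ = 8(C₀+5)/ε₁`. [folklore] -/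
theorem aux_ratio_le {d δ C₀ ε₁ ρ x z : ℝ} (hδ0 : 0 < δ) (hC₀ : 0 < C₀) (hε₁ : 0 < ε₁) (hd : 0 < d) (hδd : δ < d)
    (hρlt : ρ < (2 * d + C₀ * δ) / δ + 1) (hx : x ≤ ρ + 2) (hz : ε₁ / (8 * δ) ≤ z) :
    x / z ≤ 8 * (C₀ + 5) / ε₁ * d := by
  have hz0 : 0 < z := lt_of_lt_of_le (by positivity) hz
  rw [div_le_iff₀ hz0]
  have h1 : x ≤ (2 * d + C₀ * δ) / δ + 3 := by linarith
  have h2 : (2 * d + C₀ * δ) / δ + 3 = (2 * d + (C₀ + 3) * δ) / δ := by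
    rw [eq_div_iff hδ0.ne', add_mul, div_mul_cancel₀ _ hδ0.ne']; ring
  have h3 : 2 * d + (C₀ + 3) * δ ≤ (C₀ + 5) * d := by
    have := mul_le_mul_of_nonneg_left hδd.le (by positivity : (0 : ℝ) ≤ C₀ + 3)
    linarith
  have h4 : x * δ ≤ (C₀ + 5) * d := by
    have := mul_le_mul_of_nonneg_right h1 hδ0.le
    rw [h2, div_mul_cancel₀ _ hδ0.ne'] at this
    linarith
  have h5 : 8 * (C₀ + 5) / ε₁ * d * (ε₁ / (8 * δ)) = (C₀ + 5) * d / δ := by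
    have hε0 : (8 : ℝ) * ε₁ ≠ 0 := by positivity
    rw [div_mul_eq_mul_div, div_mul_div_comm,
      show 8 * (C₀ + 5) * d * ε₁ = (C₀ + 5) * d * (8 * ε₁) by ring, show ε₁ * (8 * δ) = δ * (8 * ε₁) by ring]
    exact mul_div_mul_right _ _ hε0
  have h6 : x ≤ (C₀ + 5) * d / δ := by rw [le_div_iff₀ hδ0]; linarith [h4]
  have h7 : 8 * (C₀ + 5) / ε₁ * d * (ε₁ / (8 * δ)) ≤ 8 * (C₀ + 5) / ε₁ * d * z :=
    mul_le_mul_of_nonneg_left hz (by positivity)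
  linarith [h5, h6, h7]

/-- Arithmetic of the collar: `2δ(R+1) + C₀δ ≤ ε₁`. [folklore] -/
theorem aux_collar_le {δ C₀ ε₁ R : ℝ} (hδ0 : 0 < δ) (hC₀ : 0 < C₀) (hδε : (C₀ + 5) * δ < ε₁ / 16)
    (hRle : R ≤ ε₁ / (4 * δ)) : 2 * δ * (R + 1) + C₀ * δ ≤ ε₁ := by
  have h1 : 2 * δ * R ≤ ε₁ / 2 := by
    have := mul_le_mul_of_nonneg_left hRle (by positivity : (0 : ℝ) ≤ 2 * δ)
    rwa [show 2 * δ * (ε₁ / (4 * δ)) = ε₁ / 2 by field_simp; ring] at this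
  nlinarith

namespace KCSectionFamily

variable (𝓕 : KCSectionFamily) {Ω : Set ℂ}

/-- **The Dirichlet boundary condition of the Kadanoff–Ceva primitive along the mesh** (CHI15 §3.4,
(3.20) with the weak Beurling estimate): under the a-priori bound on the collar, `Hw δ - c δ` is
`η`-small relative to the bound at the free sites within `d = d(η)` of `Ωᶜ`, for all small `δ`. [cite: ChelkakHonglerIzyurovAnnals2015, §3.4 (3.20) and Prop. 3.9 (1)] -/
theorem boundary_smallness (hΩc : Ωᶜ.Nonempty)
    (hadj : ∀ᶠ δ in 𝓝[>] (0 : ℝ), ∀ v ∈ 𝓕.Λ δ, ∀ k : Fin 4, (discreteDomainGraph Ω δ).Adj v (v + cornerUnit k))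
    (hcuts : ∀ᶠ δ in 𝓝[>] (0 : ℝ),
      IsKCCuts (discreteDomainGraph Ω δ) (𝓕.Λ δ) (𝓕.cut δ) ↑(fillFinset (touchPlaquettes (𝓕.Λ δ))))
    (hprim : ∀ᶠ δ in 𝓝[>] (0 : ℝ), IsKCPrimitive (discreteDomainGraph Ω δ) (𝓕.Λ δ) criticalBetaTwo (.fixed 1) (𝓕.B δ)
      (𝓕.cut δ) (𝓕.Hw δ) (𝓕.Hb δ) ↑(fillFinset (touchPlaquettes (𝓕.Λ δ))))
    (hHF : ∀ᶠ δ in 𝓝[>] (0 : ℝ), HoleFree (↑(𝓕.Λ δ) : Set (Site 2)))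
    {p₀ : ℝ → Site 2}
    (hodd : ∀ᶠ δ in 𝓝[>] (0 : ℝ), ∀ p ∈ touchPlaquettes (𝓕.Λ δ), p ≠ p₀ δ →
      Odd #(Finset.univ.filter fun j : Fin 4 => plaqSide p j ∈ 𝓕.cut δ p))
    {c : ℝ → ℝ}
    (hcst : ∀ᶠ δ in 𝓝[>] (0 : ℝ), ∀ (v : Site 2) (k : Fin 4), v ∉ 𝓕.Λ δ →
      faceAt v k ∈ fillFinset (touchPlaquettes (𝓕.Λ δ)) → 𝓕.Hw δ v = c δ)
    {C₀ : ℝ} (hC₀ : 0 < C₀)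
    (hvis : ∀ᶠ δ in 𝓝[>] (0 : ℝ), ∀ w ∉ Ω, ∃ p ∉ 𝓕.Λ δ, dist (meshPoint δ p) w ≤ C₀ * δ)
    {ε₁ : ℝ} (hε₁ : 0 < ε₁)
    (hfar : ∀ᶠ δ in 𝓝[>] (0 : ℝ), (∀ b ∈ 𝓕.B δ, 2 * ε₁ ≤ infDist (meshPoint δ b) Ωᶜ) ∧
      2 * ε₁ ≤ infDist (meshPoint δ (p₀ δ)) Ωᶜ)
    {M : ℝ} (hM : 0 < M) {N : ℝ → ℝ} (hN : ∀ᶠ δ in 𝓝[>] (0 : ℝ), 0 < N δ)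
    (hapriori : ∀ᶠ δ in 𝓝[>] (0 : ℝ), ∀ y : Site 2, infDist (meshPoint δ y) Ωᶜ ≤ ε₁ →
      (y ∈ 𝓕.Λ δ → |𝓕.Hw δ y - c δ| ≤ M * N δ) ∧ (y ∈ touchPlaquettes (𝓕.Λ δ) → |𝓕.Hb δ y - c δ| ≤ M * N δ)) :
    ∀ η > 0, ∃ d > 0, ∀ᶠ δ in 𝓝[>] (0 : ℝ), ∀ y ∈ 𝓕.Λ δ, infDist (meshPoint δ y) Ωᶜ ≤ d →
      |𝓕.Hw δ y - c δ| ≤ η * (M * N δ) := by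
  intro η hη
  -- the ratio factor and the choice of `d`
  obtain ⟨κ, hκ⟩ : ∃ κ : ℝ, κ = 8 * (C₀ + 5) / ε₁ := ⟨_, rfl⟩
  have hκ0 : 0 < κ := by rw [hκ]; positivity
  have hlimd := tendsto_decay_profiles κ
  have hevd : ∀ᶠ d in 𝓝[>] (0 : ℝ),
      beurlingConst * (κ * d) ^ beurlingExp + endDecayConst * (κ * d) ^ endDecayExp < η ∧ d < ε₁ / 16 := by
    have h1 : ∀ᶠ d in 𝓝 (0 : ℝ), beurlingConst * (κ * d) ^ beurlingExp + endDecayConst * (κ * d) ^ endDecayExp < η :=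
      hlimd (Iio_mem_nhds hη)
    have h2 : ∀ᶠ d in 𝓝 (0 : ℝ), d < ε₁ / 16 := Iio_mem_nhds (by positivity)
    exact mem_nhdsWithin_of_mem_nhds (h1.and h2)
  obtain ⟨d, ⟨hdη, hdε⟩, hd0⟩ := (hevd.and self_mem_nhdsWithin).exists
  have hd0 : (0 : ℝ) < d := hd0
  refine ⟨d, hd0, ?_⟩
  have hC := one_le_beurlingConst
  have hA := endDecayConst_pos
  have hβ := beurlingExp_pos
  have hγ := endDecayExp_pos
  have hδev : ∀ᶠ δ in 𝓝[>] (0 : ℝ), δ < min d (ε₁ / (16 * (C₀ + 5))) :=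
    mem_nhdsWithin_of_mem_nhds (Iio_mem_nhds (by positivity))
  filter_upwards [hadj, hcuts, hprim, hHF, hodd, hcst, hvis, hfar, hN, hapriori, hδev, self_mem_nhdsWithin]
    with δ hadj hcuts hprim hHF hodd hcst hvis hfar hN hapriori hδ hδ0
  intro y hy hyd
  have hδ0 : (0 : ℝ) < δ := hδ0
  have hδd : δ < d := hδ.trans_le (min_le_left _ _)
  have hδε : δ < ε₁ / (16 * (C₀ + 5)) := hδ.trans_le (min_le_right _ _)
  have hδε' : δ * (16 * (C₀ + 5)) < ε₁ := by rwa [lt_div_iff₀ (by positivity)] at hδε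
  have hδε'' : (C₀ + 5) * δ < ε₁ / 16 := by rw [lt_div_iff₀ (by norm_num)]; linarith
  have hle : discreteDomainGraph Ω δ ≤ zdGraph 2 := discreteDomainGraph_le_zdGraph Ω δ
  -- a point of `Ωᶜ` within `2d` of `y`, a frozen site `p` within `C₀ δ` of it, a frozen neighbour
  obtain ⟨w, hwΩ, hyw⟩ : ∃ w ∈ Ωᶜ, dist (meshPoint δ y) w < 2 * d :=
    (Metric.infDist_lt_iff hΩc).1 (by linarith)
  obtain ⟨p, hpΛ, hpw⟩ := hvis w hwΩ
  obtain ⟨k₀, hk₀⟩ := exists_frozen_neighbour hHF hpΛ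
  have hyp : dist (meshPoint δ y) (meshPoint δ p) ≤ 2 * d + C₀ * δ := by
    have := dist_triangle (meshPoint δ y) w (meshPoint δ p)
    rw [dist_comm w] at this
    linarith
  -- the lattice radii
  obtain ⟨R, hRdef⟩ : ∃ R : ℕ, R = ⌊ε₁ / (4 * δ)⌋₊ := ⟨_, rfl⟩
  obtain ⟨ρ, hρdef⟩ : ∃ ρ : ℕ, ρ = ⌈(2 * d + C₀ * δ) / δ⌉₊ := ⟨_, rfl⟩
  have hq0 : 0 ≤ ε₁ / (4 * δ) := by positivity
  have hRle : (R : ℝ) ≤ ε₁ / (4 * δ) := hRdef ▸ Nat.floor_le hq0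
  have hRlt : ε₁ / (4 * δ) < (R : ℝ) + 1 := hRdef ▸ Nat.lt_floor_add_one _
  have hρge : (2 * d + C₀ * δ) / δ ≤ (ρ : ℝ) := hρdef ▸ Nat.le_ceil _
  have hρlt : (ρ : ℝ) < (2 * d + C₀ * δ) / δ + 1 := hρdef ▸ Nat.ceil_lt_add_one (by positivity)
  -- `ρ + 3 ≤ R`
  have hρR_real : (ρ : ℝ) + 3 ≤ (R : ℝ) := aux_rho_add_three_le hδ0 hε₁ hdε hδε'' hρlt hRlt
  have hρR : ρ + 3 ≤ R := by exact_mod_cast hρR_real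
  -- `y ∈ sqBox p ρ`
  have hyρ : y ∈ sqBox p ρ := by
    refine mem_sqBox_of_dist_meshPoint_le hδ0 (hyp.trans ?_)
    have : (2 * d + C₀ * δ) = δ * ((2 * d + C₀ * δ) / δ) := by field_simp
    rw [this]; push_cast
    exact mul_le_mul_of_nonneg_left hρge hδ0.le
  -- the collar: boxes of radius `R + 1` about `p` are within `ε₁` of `Ωᶜ`
  have hcollar0 := aux_collar_le hδ0 hC₀ hδε'' hRle
  have hcollar : ∀ q : Site 2, q ∈ sqBox p ((R : ℤ) + 1) → infDist (meshPoint δ q) Ωᶜ ≤ ε₁ := by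
    intro q hq
    have h1 : dist (meshPoint δ q) (meshPoint δ p) ≤ 2 * δ * ((R : ℝ) + 1) := by
      have := dist_meshPoint_le_two_mul_of_mem_sqBox hδ0.le hq; push_cast at this; exact this
    have h2 := dist_triangle (meshPoint δ q) (meshPoint δ p) w
    exact (infDist_le_dist_of_mem hwΩ).trans (by linarith)
  -- the background spins and the source are outside `sqBox p R`
  have hBfar : ∀ b ∈ 𝓕.B δ, b ∉ sqBox p R := fun b hb hbR => by
    have h1 := hcollar b (sqBox_mono p (by omega) hbR)
    have h2 := hfar.1 b hb
    linarith
  set c₀ : Site 2 := faceAt p k₀ with hc₀def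
  have hp₀far : p₀ δ ∉ sqBox c₀ ((R - 1 : ℕ) : ℤ) := fun hin => by
    have h0 : ((R - 1 : ℕ) : ℤ) + 1 ≤ (R : ℤ) + 1 := by omega
    have h1 := hcollar (p₀ δ) (sqBox_mono p h0 (sqBox_faceAt_subset p k₀ _ hin))
    linarith [hfar.2]
  -- LOWER bound at `y`
  have hMN : 0 < M * N δ := mul_pos hM hN
  have hlow := hprim.le_hw_near_frozen hadj hle hcuts hHF hpΛ hBfar (c := c δ) (m := c δ - M * N δ) (by linarith) hcst
    (fun w' hw' hw'R hw'R1 => by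
      have := ((hapriori w' (hcollar w' hw'R1)).1 hw')
      rw [abs_le] at this; linarith) (show ρ ≤ R by omega) hy hyρ
  -- UPPER bound at `y` through `Hb (faceAt y 0) = Hb y`
  have hyt : y ∈ touchPlaquettes (𝓕.Λ δ) := by simpa [faceAt_zero_eq] using faceAt_mem_touchPlaquettes hy 0
  have hyρ' : y ∈ sqBox c₀ ((ρ + 1 : ℕ) : ℤ) := by
    have := sqBox_subset_sqBox_faceAt p k₀ (ρ : ℤ) hyρ; push_cast; exact this
  have hbd : ∀ q ∈ touchPlaquettes (𝓕.Λ δ), q ∈ sqBox c₀ (((R - 1 : ℕ) : ℤ) + 1) → 𝓕.Hb δ q ≤ c δ + M * N δ := by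
    intro q hq hqbox
    have h0 : ((R - 1 : ℕ) : ℤ) + 1 + 1 ≤ (R : ℤ) + 1 := by omega
    have h1 := hcollar q (sqBox_mono p h0 (sqBox_faceAt_subset p k₀ _ hqbox))
    have := (hapriori q h1).2 hq
    rw [abs_le] at this; linarith
  have hup := hprim.hb_le_near_frozen hadj (fun _ _ => rfl) hcuts hHF hodd hcst hpΛ hk₀ (Or.inl rfl) hp₀far hMN hbd
    (show ρ + 1 ≤ R - 1 by omega) hyt hyρ'
  have hwb : 𝓕.Hw δ y ≤ 𝓕.Hb δ y := by
    have := hprim.hw_le_hb _ (Finset.mem_coe.2 (subset_fillFinset _ (faceAt_mem_touchPlaquettes hy 0)))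
    rwa [faceAt_zero_eq] at this
  -- the ratios are at most `κ d`
  have hR3 : 3 ≤ R := le_trans (by omega) hρR
  have hRbig : ε₁ / (8 * δ) ≤ (R : ℝ) := by
    have h1 : ε₁ / (4 * δ) - 1 ≤ (R : ℝ) := by linarith
    have h2 : 1 ≤ ε₁ / (8 * δ) := by
      rw [le_div_iff₀ (by positivity)]; nlinarith
    have h3 : ε₁ / (4 * δ) = 2 * (ε₁ / (8 * δ)) := by field_simp; ring
    linarith
  have hratio : ∀ x : ℝ, 0 ≤ x → x ≤ (ρ : ℝ) + 2 → ∀ z : ℝ, ε₁ / (8 * δ) ≤ z → x / z ≤ κ * d := by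
    intro x _ hx z hz
    rw [hκ]
    exact aux_ratio_le hδ0 hC₀ hε₁ hd0 hδd hρlt hx hz
  have hr1 : (((ρ : ℝ) + 1) / ((R : ℝ) + 1)) ≤ κ * d :=
    hratio _ (by positivity) (by linarith) _ (by linarith)
  have hr2 : ((((ρ + 1 : ℕ) : ℝ) + 1) / (((R - 1 : ℕ) : ℝ) + 1)) ≤ κ * d := by
    have e : (((R - 1 : ℕ) : ℝ) + 1) = (R : ℝ) := by
      rw [Nat.cast_sub (by omega)]; push_cast; ring
    rw [e]
    exact hratio _ (by positivity) (by push_cast; linarith) _ hRbig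
  have hpow1 : beurlingConst * (((ρ : ℝ) + 1) / ((R : ℝ) + 1)) ^ beurlingExp ≤ beurlingConst * (κ * d) ^ beurlingExp :=
    mul_le_mul_of_nonneg_left (Real.rpow_le_rpow (by positivity) hr1 hβ.le) (by linarith)
  have hpow2 : endDecayConst * endProfile (R - 1) (ρ + 1) ≤ endDecayConst * (κ * d) ^ endDecayExp :=
    mul_le_mul_of_nonneg_left (Real.rpow_le_rpow (by positivity) hr2 hγ.le) hA.le
  have hpos1 : 0 ≤ beurlingConst * (((ρ : ℝ) + 1) / ((R : ℝ) + 1)) ^ beurlingExp := by positivity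
  have hpos2 : 0 ≤ endDecayConst * endProfile (R - 1) (ρ + 1) := mul_nonneg hA.le (endProfile_pos _ _).le
  have hposκ1 : 0 ≤ beurlingConst * (κ * d) ^ beurlingExp := by positivity
  have hposκ2 : 0 ≤ endDecayConst * (κ * d) ^ endDecayExp := by positivity
  have hX1 : beurlingConst * (((ρ : ℝ) + 1) / ((R : ℝ) + 1)) ^ beurlingExp ≤ η := by linarith
  have hX2 : endDecayConst * endProfile (R - 1) (ρ + 1) ≤ η := by linarith
  have hm1 := mul_le_mul_of_nonneg_left hX1 hMN.le
  have hm2 := mul_le_mul_of_nonneg_left hX2 hMN.le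
  -- conclusion
  rw [abs_le]
  constructor
  · -- lower
    have h' : c δ - (c δ - (c δ - M * N δ)) * (beurlingConst * (((ρ : ℝ) + 1) / ((R : ℝ) + 1)) ^ beurlingExp) ≤ 𝓕.Hw δ y := hlow
    have e : c δ - (c δ - (c δ - M * N δ)) * (beurlingConst * (((ρ : ℝ) + 1) / ((R : ℝ) + 1)) ^ beurlingExp) =
        c δ - M * N δ * (beurlingConst * (((ρ : ℝ) + 1) / ((R : ℝ) + 1)) ^ beurlingExp) := by ring
    rw [e] at h'
    linarith
  · -- upper
    linarith

end KCSectionFamily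

end Literature.Probability.LatticeModels
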